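import Literature.AlgebraicGeometry.ModuliOfAbelianVarieties.SiegelAdmissibleFibreRigidity
import Literature.AlgebraicGeometry.ModuliOfAbelianVarieties.SiegelRebaseTowerProportionality
import Literature.AlgebraicGeometry.AbelianSchemes.SymplecticLiftsDifferByPrincipalLevelOne
import Literature.AlgebraicGeometry.AbelianSchemes.SymplecticLiftConjTransport
import Literature.NumberTheory.Adeles.IntegralAdeleResidue
import Literature.AlgebraicGeometry.ModuliOfAbelianVarieties.SiegelMarkedFibreTransportAlongId
import HarnessLib

/-!
# At a special point, the canonical identification `(A_s)^σ ≅ A_{σs}` IS the CM isogeny: an isomorphism `(A_s)^σ ≅ A_{Spec σ ≫ s}` reading the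
# markings like the CM isogeny coincides with `conjFibreIso` ([Milne 2005] §14 Prop. 14.12 + Thm. 6.11 + lemma of Serre; [Deligne 1971] 4.16–4.19)

Topic `AlgebraicGeometry/ModuliOfAbelianVarieties`; namespace `Literature.AlgebraicGeometry.ModuliOfAbelianVarieties.SiegelAdelicMarking`.
THEOREMS ONLY (no definition, no named fact, no instance, no `sorry`; net Literature debt 0).  Cell `hodgecm-mathlib` (D-0151), FLOOR 0, P6
door (E) of `stub_RGD`, E6 step 8 — **E6-γ KERNEL (generic half)**: the hypothesis `hint` of ★ (G2b-α) `forall_point_comp_galA_of_conjugate_comp_eq`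
for the canonical `e₁ := conjFibreIso` is obtained by showing `e₂ = e₁` for the CM isogeny `e₂` (then ★ E6-γ-A₂ transports the intertwining).
`--supports stmt-HodgeConjecture-24832`, count-neutral; HC_CM is proved only modulo the printed citations until rung 0 closes.

SETTING (ONE abelian scheme `B → S` with dual pair `D`, `λ : B → B̂`, level-`N` structure `φ`, `N ≥ 3`; a complex point `s` and its twist
`s₂ := Spec σ ≫ s`, `σ ∈ Aut(ℂ/ℚ)`): at `s` a symplectic lift `Λ₁` of `(φ, Θ₁)` read through a marking `m₁` by `[J, a]` and a witness `λ̄ = Λ(𝒪(Θ₁))`; at `s₂` an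
ADMISSIBILITY DATUM `(m₂, Θ₂, Λ₂)` at `(Z, r)` (the block of ★ MRK-UNIQ ∕ the organ's `ReadsC` (ii)); an ISOMORPHISM `e₂ : (B_s)^σ ≅ B_{s₂}` with the
`K_δ(N)`-twisted CM torsion reading «`e₂((m₁.r v)^σ) = m₂.r w` whenever `k a⁻¹ v̂ ≡ r⁻¹ ŵ`» (★ `CMConjugationIsogenyAll`, re-indexed at the twisted point).
THEN **`e₂ = conjFibreIso B σ s`** (`iso_hom_eq_conjFibreIso_hom_of_lifts`); and (ED. 2, with ★ E6-γ-A₂) **`y^σ ≫ conjFibreIso = conjFibreIso ≫ y′`** for endomorphisms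
reading a congruence-preserving pair `(ℓ, ℓ′)` through `m₁`, `m₂` (`conjugate_comp_conjFibreIso_eq_of_lifts`) — the `hint` of ★ (G2b-α); ED. 3 adds the `Hom` forms (`hom_eq_conjFibreIso_hom_of_lifts`,
`conjugate_comp_conjFibreIso_eq_of_lifts_of_hom`: a CM HOMOMORPHISM with the twisted reading is automatically an iso, ★ R60-57b).
PROOF.  `u := e₁⁻¹ ≫ e₂ ∈ Aut(B_{s₂})` carries the tower `Λ₂` to a `K_δ(N)`-re-indexing of itself: the conjugate transport `Λ♮ := e₁ ∘ (Λ₁)^σ`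
(★ `exists_conjTransport_lift_eq`) and `Λ₂` are two symplectic lifts of `(φ, Θ₂)` at `s₂`, so `Λ₂ = Λ♮ ∘ γ̄` for a `γ ∈ K_δ(1)` (★
`exists_mem_principalLevelSubgroup_one_lift_eq`), `≡ 1 (mod N)` because both extend `φ` (★ `mem_principalLevelSubgroup_iff_forall_integralAdeleResidue_eq`);
and `e₂ ∘ (Λ₁)^σ = Λ₂ ∘ k̄` (★ `map_conjPoints_lift_eq_lift_reindex_mulVec`).  Hence `u ∘ Λ₂ = Λ₂ ∘ k̄ ∘ γ̄` is the lift
`(Λ₂.reindex T_k).reindex T_γ` (★ `reindexTowerOf`, ★ `reindex`) FOR THE SAME WITNESS `Θ₂`, and ★ (ED. 3) `iso_hom_eq_iso_hom_of_symplecticLift` (lemma of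
Serre via ★ MRK-UNIQ) gives `e₂ = e₁`.

## References
* [Milne2005ShimuraVarieties] J. S. Milne, *Introduction to Shimura varieties* (2005), §14 Prop. 14.12 p. 125, §6 Thm. 6.11 pp. 74–75, Lemma 5.13 p. 57.
* [Deligne1971TravauxShimura] P. Deligne, *Travaux de Shimura* (1971), 4.12 (b), 4.16–4.19 pp. 149–151.
* [MumfordFogartyKirwan1994] D. Mumford, J. Fogarty, F. Kirwan, *Geometric Invariant Theory*, 3rd ed. (1994), Ch. 7 §3 (lemma of Serre).
* [Lan2013PELCompactifications] K.-W. Lan, *Arithmetic compactifications of PEL-type Shimura varieties* (2013), §1.3.6 Lemma 1.3.6.5.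
-/

set_option autoImplicit false

noncomputable section

open Matrix CategoryTheory AlgebraicGeometry
open Literature.AlgebraicGeometry.Motives (AbelianVariety AlgPoints CartierDivisor)
open Literature.AlgebraicGeometry.AbelianSchemes (AbelianSchemeOver)
open Literature.NumberTheory.Automorphic (siegelUpperHalfSpace)
open Literature.NumberTheory.Adeles (integralAdeleResidue mem_principalLevelSubgroup_iff_forall_integralAdeleResidue_eq)

namespace Literature.AlgebraicGeometry.ModuliOfAbelianVarieties

namespace SiegelAdelicMarking

open SiegelModuli

variable {g : ℕ} {δ : Fin g → ℕ} {J : C0pm δ} {a k : gspFinAdelic δ}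
variable {N : ℕ} {S : Scheme} {B : AbelianSchemeOver S} {s : Spec (CommRingCat.of ℂ) ⟶ S} {D : B.DualPair} {lam : B.X ⟶ D.hat.X}
  {φ : B.LevelStructure g N} {r : gspFinAdelic δ} {Z : Matrix (Fin g) (Fin g) ℂ}

/-- **E6-γ KERNEL — THE CANONICAL IDENTIFICATION IS THE CM ISOGENY.**  With the data of the module docstring: an isomorphism
`e₂ : (B_s)^σ ≅ B_{Spec σ ≫ s}` which READS the markings like the CM isogeny of ★ `CMConjugationIsogenyAll` (`K_δ(N)`-twisted torsion reading between the
marking `m₁` at `s`, through which the symplectic lift `Λ₁` of `(φ, Θ₁)` reads, and the ADMISSIBLE marking `m₂` at the twisted point) IS the canonical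
`conjFibreIso B σ s` ([Milne2005ShimuraVarieties] §14 Prop. 14.12 «`σ(A, i, λ, ηK) ≅ (A′, …)`» + Thm. 6.11 + the lemma of Serre: the composite
`conjFibreIso⁻¹ ≫ e₂` is an automorphism of the rigid triple `(B_{σs}, λ, φ)`).  Consequence (★ E6-γ-A₂ + ★ G2b-α): the canonical identification intertwines the
endomorphisms read through the two markings — B-γ's fibre hypothesis at a special point.
[cite: Milne2005ShimuraVarieties, §14 Prop. 14.12 p. 125; §6 Thm. 6.11 pp. 74–75] [cite: Deligne1971TravauxShimura, 4.12 (b) p. 149 and 4.16 p. 150]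
[cite: MumfordFogartyKirwan1994, Ch. 7 §3 (lemma of Serre)] -/
theorem iso_hom_eq_conjFibreIso_hom_of_lifts (hg : 0 < g) (hδ : IsPolarizationType δ) (hN : 3 ≤ N)
    (σ : ℂ ≃ₐ[ℚ] ℂ)
    -- the datum at `s`: a marking `m₁` by `[J, a]`, a `λ`-witness `Θ₁`, a symplectic lift `Λ₁` read through `m₁`
    {Θ₁ : CartierDivisor (B.fibre s).toAbelianVariety.X.left} (h₁ : B.IsLambdaOfAt s D lam Θ₁)
    (Λ₁ : φ.SymplecticLift s Θ₁ δ) (m₁ : SiegelAdelicMarking J a (B.fibre s).toAbelianVariety)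
    (hΛ₁ : ∀ ⦃M : ℕ⦄, N ∣ M → M ≠ 0 → ∀ (x : Fin g ⊕ Fin g → ZMod M) (v : Fin g ⊕ Fin g → ℚ),
      AdelicCongr ((a⁻¹ : gspFinAdelic δ) : GL (Fin g ⊕ Fin g) finAdeleQ) 1 v (fun i => ((x i).val : ℚ) / M) →
        ((Λ₁.lift M (Multiplicative.ofAdd x)) : (B.fibre s).toAbelianVariety.Points ℂ) = m₁.r v)
    -- the admissibility datum at the twisted point `Spec σ ≫ s`
    (hr : r ∈ principalLevelSubgroup δ 1) (hZ : Z ∈ siegelUpperHalfSpace g)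
    (m₂ : SiegelAdelicMarking ⟨jOfSiegel δ Z, SiegelComplexRecordSystem.jOfSiegel_mem_C0pm hδ.1 hZ⟩ r
      (B.fibre (AbelianSchemeOver.specTwist σ.toRingEquiv ≫ s)).toAbelianVariety)
    {Θ₂ : CartierDivisor (B.fibre (AbelianSchemeOver.specTwist σ.toRingEquiv ≫ s)).toAbelianVariety.X.left}
    (Λ₂ : φ.SymplecticLift (AbelianSchemeOver.specTwist σ.toRingEquiv ≫ s) Θ₂ δ)
    (h₂ : B.IsLambdaOfAt (AbelianSchemeOver.specTwist σ.toRingEquiv ≫ s) D lam Θ₂)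
    (hΛ₂ : ∀ ⦃M : ℕ⦄, N ∣ M → M ≠ 0 → ∀ (x : Fin g ⊕ Fin g → ZMod M) (v : Fin g ⊕ Fin g → ℚ),
      AdelicCongr ((r⁻¹ : gspFinAdelic δ) : GL (Fin g ⊕ Fin g) finAdeleQ) 1 v (fun i => ((x i).val : ℚ) / M) →
        ((Λ₂.lift M (Multiplicative.ofAdd x)) : (B.fibre (AbelianSchemeOver.specTwist σ.toRingEquiv ≫ s)).toAbelianVariety.Points ℂ) =
          m₂.r v)
    -- the CM isomorphism and its `K_δ(N)`-twisted torsion reading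
    (e₂ : ((B.fibre s).toAbelianVariety).conjugate σ.toRingEquiv ≅ (B.fibre (AbelianSchemeOver.specTwist σ.toRingEquiv ≫ s)).toAbelianVariety)
    (hk : k ∈ principalLevelSubgroup δ N)
    (hf : ∀ v w : Fin g ⊕ Fin g → ℚ,
      AdelicCongr ((k * a⁻¹ : gspFinAdelic δ) : GL (Fin g ⊕ Fin g) finAdeleQ)
          ((r⁻¹ : gspFinAdelic δ) : GL (Fin g ⊕ Fin g) finAdeleQ) v w →
        AlgPoints.map e₂.hom.hom.hom.hom ((B.fibre s).toAbelianVariety.conjPoints σ.toRingEquiv (m₁.r v)) = m₂.r w) :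
    e₂.hom = (B.conjFibreIso σ.toRingEquiv s).hom := by
  have hN0 : N ≠ 0 := by omega
  -- (1) the conjugate transport `Λ♮ = e₁ ∘ (Λ₁)^σ`, a symplectic lift of `(φ, Θ₂)` at the twisted point
  obtain ⟨Λn, -, hΛn⟩ :=
    AbelianSchemeOver.LevelStructure.SymplecticLift.exists_conjTransport_lift_eq (D := D) (lam := lam) σ.toRingEquiv h₁ h₂ Λ₁
  -- (2) `Λ₂ = Λ♮ ∘ γ̄` for a `γ ∈ K_δ(1)`
  obtain ⟨γ, hγ1, hread⟩ :=
    AbelianSchemeOver.LevelStructure.SymplecticLift.exists_mem_principalLevelSubgroup_one_lift_eq Λn Λ₂ hN0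
  -- (3) `γ ≡ 1 (mod N)`: both lifts extend `φ` at level `N`
  have hγN : γ ∈ principalLevelSubgroup δ N := by
    haveI : NeZero N := ⟨hN0⟩
    rw [mem_principalLevelSubgroup_iff_forall_integralAdeleResidue_eq N δ hγ1]
    -- the residue matrix `γ̄_N`
    set GN : Matrix (Fin g ⊕ Fin g) (Fin g ⊕ Fin g) (ZMod N) := fun i j =>
      integralAdeleResidue N ⟨((γ : GL (Fin g ⊕ Fin g) finAdeleQ) : Matrix (Fin g ⊕ Fin g) (Fin g ⊕ Fin g) finAdeleQ) i j,
        isIntegral_of_isCongOne_one ((mem_principalLevelSubgroup_iff δ).1 hγ1).1 i j⟩ with hGN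
    have hreadN := hread N dvd_rfl GN (fun i j h => rfl)
    -- `γ̄_N eⱼ = eⱼ` for every `j`
    have hcol : ∀ j, GN *ᵥ Pi.single j 1 = Pi.single j 1 := by
      intro j
      have hlev : Λ₂.lift N (Multiplicative.ofAdd (Pi.single j 1)) = Λn.lift N (Multiplicative.ofAdd (Pi.single j 1)) :=
        Subtype.ext ((Λ₂.lift_level j).trans (Λn.lift_level j).symm)
      have h := (hreadN (Pi.single j 1)).symm.trans hlev
      exact Multiplicative.ofAdd.injective ((Λn.lift_bijective dvd_rfl hN0).1 h)
    intro i j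
    have h := congrFun (hcol j) i
    rw [Matrix.mulVec_single_one] at h
    change GN i j = _ at h
    change GN i j = (1 : Matrix (Fin g ⊕ Fin g) (Fin g ⊕ Fin g) (ZMod N)) i j
    rw [h, Matrix.one_apply, Pi.single_apply]
  -- (4) the two re-indexing towers and the lift `Λ₂′ := (Λ₂ ∘ k̄) ∘ γ̄`
  set Tk := reindexTowerOf hN0 hk with hTk
  set Tγ := reindexTowerOf hN0 hγN with hTγ
  -- `Λ₂ x = Λ♮ (γ̄ x)` with `γ̄ = Tγ.κ`
  have hreadγ : ∀ ⦃M : ℕ⦄, N ∣ M → M ≠ 0 → ∀ x : Fin g ⊕ Fin g → ZMod M,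
      Λ₂.lift M (Multiplicative.ofAdd x) = Λn.lift M (Multiplicative.ofAdd (Tγ.κ M *ᵥ x)) := by
    intro M hNM hM0 x
    haveI : NeZero M := ⟨hM0⟩
    exact hread M hNM (Tγ.κ M) (fun i j h => reindexTowerOf_κ_apply hN0 hγN i j) x
  -- the automorphism `u := e₁⁻¹ ≫ e₂` carries `Λ₂ x` to `Λ₂ (k̄ (γ̄ x))`
  have hu : ∀ ⦃M : ℕ⦄, N ∣ M → M ≠ 0 → ∀ x : Fin g ⊕ Fin g → ZMod M,
      AlgPoints.map ((B.conjFibreIso σ.toRingEquiv s).symm ≪≫ e₂).hom.hom.hom.hom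
          ((Λ₂.lift M (Multiplicative.ofAdd x) :
              (B.fibre (AbelianSchemeOver.specTwist σ.toRingEquiv ≫ s)).toAbelianVariety.torsionPoints ℂ (M : ℤ)) :
            (B.fibre (AbelianSchemeOver.specTwist σ.toRingEquiv ≫ s)).toAbelianVariety.Points ℂ) =
        ((Λ₂.lift M (Multiplicative.ofAdd (Tk.κ M *ᵥ (Tγ.κ M *ᵥ x))) :
            (B.fibre (AbelianSchemeOver.specTwist σ.toRingEquiv ≫ s)).toAbelianVariety.torsionPoints ℂ (M : ℤ)) :
          (B.fibre (AbelianSchemeOver.specTwist σ.toRingEquiv ≫ s)).toAbelianVariety.Points ℂ) := by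
    intro M hNM hM0 x
    -- `u (Λ₂ x) = e₂ (e₁⁻¹ (e₁ ((Λ₁ (γ̄ x))^σ))) = e₂ ((Λ₁ (γ̄ x))^σ) = Λ₂ (k̄ (γ̄ x))`
    have e : ((B.conjFibreIso σ.toRingEquiv s).symm ≪≫ e₂).hom.hom.hom.hom =
        (B.conjFibreIso σ.toRingEquiv s).inv.hom.hom.hom ≫ e₂.hom.hom.hom.hom := rfl
    have hc : ∀ Y : ((B.fibre s).toAbelianVariety.conjugate σ.toRingEquiv).Points ℂ,
        AlgPoints.map (B.conjFibreIso σ.toRingEquiv s).inv.hom.hom.hom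
          (AlgPoints.map (B.conjFibreIso σ.toRingEquiv s).hom.hom.hom.hom Y) = Y := fun Y => by
      have e' : (B.conjFibreIso σ.toRingEquiv s).hom.hom.hom.hom ≫ (B.conjFibreIso σ.toRingEquiv s).inv.hom.hom.hom =
          ((B.conjFibreIso σ.toRingEquiv s).hom ≫ (B.conjFibreIso σ.toRingEquiv s).inv).hom.hom.hom := rfl
      rw [← AlgPoints.map_comp_apply, e', Iso.hom_inv_id]
      exact AlgPoints.map_id_apply Y
    rw [e, AlgPoints.map_comp_apply, congrArg Subtype.val (hreadγ hNM hM0 x), hΛn, hc]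
    exact map_conjPoints_lift_eq_lift_reindex_mulVec hN0 σ.toRingEquiv hk Λ₁ m₁ hΛ₁ Λ₂ m₂ hΛ₂ e₂.hom hf hNM hM0 _
  -- (5) Serre rigidity with the SAME witness `Θ₂` and the re-indexed lift
  refine SiegelAdelicMarking.iso_hom_eq_iso_hom_of_symplecticLift hg hδ hN hr hZ m₂ Λ₂ h₂ hΛ₂
    (B.conjFibreIso σ.toRingEquiv s) e₂ ((Λ₂.reindex Tk).reindex Tγ) ?_
  intro M hNM hM0 x v hv
  rw [AbelianSchemeOver.LevelStructure.SymplecticLift.reindex_lift_ofAdd,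
    AbelianSchemeOver.LevelStructure.SymplecticLift.reindex_lift_ofAdd, ← hΛ₂ hNM hM0 x v hv]
  exact (hu hNM hM0 x).symm

/-- **E6-γ AT A SPECIAL POINT — THE CANONICAL IDENTIFICATION INTERTWINES THE TWO READINGS** (kernel `iso_hom_eq_conjFibreIso_hom_of_lifts` + ★ E6-γ-A₂
`conjugate_comp_eq_comp_of_adelicCongr₂`): with the data of the kernel, endomorphisms `y` of `B_s` reading `ℓ` through `m₁` and `y′` of `B_{Spec σ ≫ s}` reading
`ℓ′` through `m₂`, for a pair `(ℓ, ℓ′)` preserving the congruence `k a⁻¹ v̂ ≡ r⁻¹ ŵ`, satisfy **`y^σ ≫ conjFibreIso = conjFibreIso ≫ y′`** — the hypothesis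
`hint` of ★ (G2b-α) `AbelianSchemeOver.forall_point_comp_galA_of_conjugate_comp_eq`, i.e. B-γ's fibre identity at the special point.
[cite: Milne2005ShimuraVarieties, §14 Prop. 14.12 p. 125 and §11 Thm. 11.2 p. 108] [cite: Deligne1971TravauxShimura, 4.16–4.19 pp. 150–151]
[cite: MumfordFogartyKirwan1994, Ch. 7 §3 (lemma of Serre)] -/
theorem conjugate_comp_conjFibreIso_eq_of_lifts (hg : 0 < g) (hδ : IsPolarizationType δ) (hN : 3 ≤ N)
    (σ : ℂ ≃ₐ[ℚ] ℂ)
    {Θ₁ : CartierDivisor (B.fibre s).toAbelianVariety.X.left} (h₁ : B.IsLambdaOfAt s D lam Θ₁)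
    (Λ₁ : φ.SymplecticLift s Θ₁ δ) (m₁ : SiegelAdelicMarking J a (B.fibre s).toAbelianVariety)
    (hΛ₁ : ∀ ⦃M : ℕ⦄, N ∣ M → M ≠ 0 → ∀ (x : Fin g ⊕ Fin g → ZMod M) (v : Fin g ⊕ Fin g → ℚ),
      AdelicCongr ((a⁻¹ : gspFinAdelic δ) : GL (Fin g ⊕ Fin g) finAdeleQ) 1 v (fun i => ((x i).val : ℚ) / M) →
        ((Λ₁.lift M (Multiplicative.ofAdd x)) : (B.fibre s).toAbelianVariety.Points ℂ) = m₁.r v)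
    (hr : r ∈ principalLevelSubgroup δ 1) (hZ : Z ∈ siegelUpperHalfSpace g)
    (m₂ : SiegelAdelicMarking ⟨jOfSiegel δ Z, SiegelComplexRecordSystem.jOfSiegel_mem_C0pm hδ.1 hZ⟩ r
      (B.fibre (AbelianSchemeOver.specTwist σ.toRingEquiv ≫ s)).toAbelianVariety)
    {Θ₂ : CartierDivisor (B.fibre (AbelianSchemeOver.specTwist σ.toRingEquiv ≫ s)).toAbelianVariety.X.left}
    (Λ₂ : φ.SymplecticLift (AbelianSchemeOver.specTwist σ.toRingEquiv ≫ s) Θ₂ δ)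
    (h₂ : B.IsLambdaOfAt (AbelianSchemeOver.specTwist σ.toRingEquiv ≫ s) D lam Θ₂)
    (hΛ₂ : ∀ ⦃M : ℕ⦄, N ∣ M → M ≠ 0 → ∀ (x : Fin g ⊕ Fin g → ZMod M) (v : Fin g ⊕ Fin g → ℚ),
      AdelicCongr ((r⁻¹ : gspFinAdelic δ) : GL (Fin g ⊕ Fin g) finAdeleQ) 1 v (fun i => ((x i).val : ℚ) / M) →
        ((Λ₂.lift M (Multiplicative.ofAdd x)) : (B.fibre (AbelianSchemeOver.specTwist σ.toRingEquiv ≫ s)).toAbelianVariety.Points ℂ) =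
          m₂.r v)
    (e₂ : ((B.fibre s).toAbelianVariety).conjugate σ.toRingEquiv ≅ (B.fibre (AbelianSchemeOver.specTwist σ.toRingEquiv ≫ s)).toAbelianVariety)
    (hk : k ∈ principalLevelSubgroup δ N)
    (hf : ∀ v w : Fin g ⊕ Fin g → ℚ,
      AdelicCongr ((k * a⁻¹ : gspFinAdelic δ) : GL (Fin g ⊕ Fin g) finAdeleQ)
          ((r⁻¹ : gspFinAdelic δ) : GL (Fin g ⊕ Fin g) finAdeleQ) v w →
        AlgPoints.map e₂.hom.hom.hom.hom ((B.fibre s).toAbelianVariety.conjPoints σ.toRingEquiv (m₁.r v)) = m₂.r w)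
    (ℓ ℓ' : Matrix (Fin g ⊕ Fin g) (Fin g ⊕ Fin g) ℚ)
    (hℓ : ∀ v w : Fin g ⊕ Fin g → ℚ,
      AdelicCongr ((k * a⁻¹ : gspFinAdelic δ) : GL (Fin g ⊕ Fin g) finAdeleQ)
          ((r⁻¹ : gspFinAdelic δ) : GL (Fin g ⊕ Fin g) finAdeleQ) v w →
        AdelicCongr ((k * a⁻¹ : gspFinAdelic δ) : GL (Fin g ⊕ Fin g) finAdeleQ)
          ((r⁻¹ : gspFinAdelic δ) : GL (Fin g ⊕ Fin g) finAdeleQ) (ℓ *ᵥ v) (ℓ' *ᵥ w))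
    (y : (B.fibre s).toAbelianVariety ⟶ (B.fibre s).toAbelianVariety)
    (hy : ∀ v : Fin g ⊕ Fin g → ℚ, AlgPoints.map y.hom.hom.hom (m₁.r v) = m₁.r (ℓ *ᵥ v))
    (y' : (B.fibre (AbelianSchemeOver.specTwist σ.toRingEquiv ≫ s)).toAbelianVariety ⟶
      (B.fibre (AbelianSchemeOver.specTwist σ.toRingEquiv ≫ s)).toAbelianVariety)
    (hy' : ∀ w : Fin g ⊕ Fin g → ℚ, AlgPoints.map y'.hom.hom.hom (m₂.r w) = m₂.r (ℓ' *ᵥ w)) :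
    AbelianVariety.Hom.conjugate σ.toRingEquiv y ≫ (B.conjFibreIso σ.toRingEquiv s).hom =
      (B.conjFibreIso σ.toRingEquiv s).hom ≫ y' := by
  rw [← iso_hom_eq_conjFibreIso_hom_of_lifts hg hδ hN σ h₁ Λ₁ m₁ hΛ₁ hr hZ m₂ Λ₂ h₂ hΛ₂ e₂ hk hf]
  exact conjugate_comp_eq_comp_of_adelicCongr₂ σ.toRingEquiv m₁ m₂ _ _ e₂.hom hf ℓ ℓ' hℓ y hy y' hy'

/-- **THE CM HOMOMORPHISM IS THE CANONICAL IDENTIFICATION — `Hom` form.**  The same for a HOMOMORPHISM `f : (B_s)^σ ⟶ B_{Spec σ ≫ s}` with the `K_δ(N)`-twisted CM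
reading (the literal output shape of ★ `CMConjugationIsogenyAll` ∕ ★ `cmConjugationIsogenyAll_holds` after re-indexing): such an `f` is automatically an isomorphism
(★ `isIso_of_mem_principalLevelSubgroup_forall_adelicCongr`, R60-57b), and `f = conjFibreIso`. [cite: Milne2005ShimuraVarieties, §14 Prop. 14.12 p. 125; §6 Thm. 6.11 pp. 74–75]
[cite: Deligne1971TravauxShimura, 4.16 p. 150] [cite: MumfordFogartyKirwan1994, Ch. 7 §3 (lemma of Serre)] -/
theorem hom_eq_conjFibreIso_hom_of_lifts (hg : 0 < g) (hδ : IsPolarizationType δ) (hN : 3 ≤ N)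
    (σ : ℂ ≃ₐ[ℚ] ℂ)
    {Θ₁ : CartierDivisor (B.fibre s).toAbelianVariety.X.left} (h₁ : B.IsLambdaOfAt s D lam Θ₁)
    (Λ₁ : φ.SymplecticLift s Θ₁ δ) (m₁ : SiegelAdelicMarking J a (B.fibre s).toAbelianVariety)
    (hΛ₁ : ∀ ⦃M : ℕ⦄, N ∣ M → M ≠ 0 → ∀ (x : Fin g ⊕ Fin g → ZMod M) (v : Fin g ⊕ Fin g → ℚ),
      AdelicCongr ((a⁻¹ : gspFinAdelic δ) : GL (Fin g ⊕ Fin g) finAdeleQ) 1 v (fun i => ((x i).val : ℚ) / M) →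
        ((Λ₁.lift M (Multiplicative.ofAdd x)) : (B.fibre s).toAbelianVariety.Points ℂ) = m₁.r v)
    (hr : r ∈ principalLevelSubgroup δ 1) (hZ : Z ∈ siegelUpperHalfSpace g)
    (m₂ : SiegelAdelicMarking ⟨jOfSiegel δ Z, SiegelComplexRecordSystem.jOfSiegel_mem_C0pm hδ.1 hZ⟩ r
      (B.fibre (AbelianSchemeOver.specTwist σ.toRingEquiv ≫ s)).toAbelianVariety)
    {Θ₂ : CartierDivisor (B.fibre (AbelianSchemeOver.specTwist σ.toRingEquiv ≫ s)).toAbelianVariety.X.left}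
    (Λ₂ : φ.SymplecticLift (AbelianSchemeOver.specTwist σ.toRingEquiv ≫ s) Θ₂ δ)
    (h₂ : B.IsLambdaOfAt (AbelianSchemeOver.specTwist σ.toRingEquiv ≫ s) D lam Θ₂)
    (hΛ₂ : ∀ ⦃M : ℕ⦄, N ∣ M → M ≠ 0 → ∀ (x : Fin g ⊕ Fin g → ZMod M) (v : Fin g ⊕ Fin g → ℚ),
      AdelicCongr ((r⁻¹ : gspFinAdelic δ) : GL (Fin g ⊕ Fin g) finAdeleQ) 1 v (fun i => ((x i).val : ℚ) / M) →
        ((Λ₂.lift M (Multiplicative.ofAdd x)) : (B.fibre (AbelianSchemeOver.specTwist σ.toRingEquiv ≫ s)).toAbelianVariety.Points ℂ) =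
          m₂.r v)
    (f : ((B.fibre s).toAbelianVariety).conjugate σ.toRingEquiv ⟶ (B.fibre (AbelianSchemeOver.specTwist σ.toRingEquiv ≫ s)).toAbelianVariety)
    (hk : k ∈ principalLevelSubgroup δ N)
    (hf : ∀ v w : Fin g ⊕ Fin g → ℚ,
      AdelicCongr ((k * a⁻¹ : gspFinAdelic δ) : GL (Fin g ⊕ Fin g) finAdeleQ)
          ((r⁻¹ : gspFinAdelic δ) : GL (Fin g ⊕ Fin g) finAdeleQ) v w →
        AlgPoints.map f.hom.hom.hom ((B.fibre s).toAbelianVariety.conjPoints σ.toRingEquiv (m₁.r v)) = m₂.r w) :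
    f = (B.conjFibreIso σ.toRingEquiv s).hom := by
  haveI : IsIso f := isIso_of_mem_principalLevelSubgroup_forall_adelicCongr σ hk m₁ m₂ f hf
  exact iso_hom_eq_conjFibreIso_hom_of_lifts hg hδ hN σ h₁ Λ₁ m₁ hΛ₁ hr hZ m₂ Λ₂ h₂ hΛ₂ (asIso f) hk hf

/-- **E6-γ AT A SPECIAL POINT, `Hom` form**: `y^σ ≫ conjFibreIso = conjFibreIso ≫ y′` from a CM HOMOMORPHISM `f` with the twisted reading, endomorphisms `y, y′`
reading a congruence-preserving pair `(ℓ, ℓ′)` through `m₁, m₂` (`hom_eq_conjFibreIso_hom_of_lifts` + ★ `conjugate_comp_eq_comp_of_adelicCongr₂`).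
[cite: Milne2005ShimuraVarieties, §14 Prop. 14.12 p. 125 and §11 Thm. 11.2 p. 108] [cite: Deligne1971TravauxShimura, 4.16–4.19 pp. 150–151] -/
theorem conjugate_comp_conjFibreIso_eq_of_lifts_of_hom (hg : 0 < g) (hδ : IsPolarizationType δ) (hN : 3 ≤ N)
    (σ : ℂ ≃ₐ[ℚ] ℂ)
    {Θ₁ : CartierDivisor (B.fibre s).toAbelianVariety.X.left} (h₁ : B.IsLambdaOfAt s D lam Θ₁)
    (Λ₁ : φ.SymplecticLift s Θ₁ δ) (m₁ : SiegelAdelicMarking J a (B.fibre s).toAbelianVariety)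
    (hΛ₁ : ∀ ⦃M : ℕ⦄, N ∣ M → M ≠ 0 → ∀ (x : Fin g ⊕ Fin g → ZMod M) (v : Fin g ⊕ Fin g → ℚ),
      AdelicCongr ((a⁻¹ : gspFinAdelic δ) : GL (Fin g ⊕ Fin g) finAdeleQ) 1 v (fun i => ((x i).val : ℚ) / M) →
        ((Λ₁.lift M (Multiplicative.ofAdd x)) : (B.fibre s).toAbelianVariety.Points ℂ) = m₁.r v)
    (hr : r ∈ principalLevelSubgroup δ 1) (hZ : Z ∈ siegelUpperHalfSpace g)
    (m₂ : SiegelAdelicMarking ⟨jOfSiegel δ Z, SiegelComplexRecordSystem.jOfSiegel_mem_C0pm hδ.1 hZ⟩ r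
      (B.fibre (AbelianSchemeOver.specTwist σ.toRingEquiv ≫ s)).toAbelianVariety)
    {Θ₂ : CartierDivisor (B.fibre (AbelianSchemeOver.specTwist σ.toRingEquiv ≫ s)).toAbelianVariety.X.left}
    (Λ₂ : φ.SymplecticLift (AbelianSchemeOver.specTwist σ.toRingEquiv ≫ s) Θ₂ δ)
    (h₂ : B.IsLambdaOfAt (AbelianSchemeOver.specTwist σ.toRingEquiv ≫ s) D lam Θ₂)
    (hΛ₂ : ∀ ⦃M : ℕ⦄, N ∣ M → M ≠ 0 → ∀ (x : Fin g ⊕ Fin g → ZMod M) (v : Fin g ⊕ Fin g → ℚ),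
      AdelicCongr ((r⁻¹ : gspFinAdelic δ) : GL (Fin g ⊕ Fin g) finAdeleQ) 1 v (fun i => ((x i).val : ℚ) / M) →
        ((Λ₂.lift M (Multiplicative.ofAdd x)) : (B.fibre (AbelianSchemeOver.specTwist σ.toRingEquiv ≫ s)).toAbelianVariety.Points ℂ) =
          m₂.r v)
    (f : ((B.fibre s).toAbelianVariety).conjugate σ.toRingEquiv ⟶ (B.fibre (AbelianSchemeOver.specTwist σ.toRingEquiv ≫ s)).toAbelianVariety)
    (hk : k ∈ principalLevelSubgroup δ N)
    (hf : ∀ v w : Fin g ⊕ Fin g → ℚ,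
      AdelicCongr ((k * a⁻¹ : gspFinAdelic δ) : GL (Fin g ⊕ Fin g) finAdeleQ)
          ((r⁻¹ : gspFinAdelic δ) : GL (Fin g ⊕ Fin g) finAdeleQ) v w →
        AlgPoints.map f.hom.hom.hom ((B.fibre s).toAbelianVariety.conjPoints σ.toRingEquiv (m₁.r v)) = m₂.r w)
    (ℓ ℓ' : Matrix (Fin g ⊕ Fin g) (Fin g ⊕ Fin g) ℚ)
    (hℓ : ∀ v w : Fin g ⊕ Fin g → ℚ,
      AdelicCongr ((k * a⁻¹ : gspFinAdelic δ) : GL (Fin g ⊕ Fin g) finAdeleQ)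
          ((r⁻¹ : gspFinAdelic δ) : GL (Fin g ⊕ Fin g) finAdeleQ) v w →
        AdelicCongr ((k * a⁻¹ : gspFinAdelic δ) : GL (Fin g ⊕ Fin g) finAdeleQ)
          ((r⁻¹ : gspFinAdelic δ) : GL (Fin g ⊕ Fin g) finAdeleQ) (ℓ *ᵥ v) (ℓ' *ᵥ w))
    (y : (B.fibre s).toAbelianVariety ⟶ (B.fibre s).toAbelianVariety)
    (hy : ∀ v : Fin g ⊕ Fin g → ℚ, AlgPoints.map y.hom.hom.hom (m₁.r v) = m₁.r (ℓ *ᵥ v))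
    (y' : (B.fibre (AbelianSchemeOver.specTwist σ.toRingEquiv ≫ s)).toAbelianVariety ⟶
      (B.fibre (AbelianSchemeOver.specTwist σ.toRingEquiv ≫ s)).toAbelianVariety)
    (hy' : ∀ w : Fin g ⊕ Fin g → ℚ, AlgPoints.map y'.hom.hom.hom (m₂.r w) = m₂.r (ℓ' *ᵥ w)) :
    AbelianVariety.Hom.conjugate σ.toRingEquiv y ≫ (B.conjFibreIso σ.toRingEquiv s).hom =
      (B.conjFibreIso σ.toRingEquiv s).hom ≫ y' := by
  rw [← hom_eq_conjFibreIso_hom_of_lifts hg hδ hN σ h₁ Λ₁ m₁ hΛ₁ hr hZ m₂ Λ₂ h₂ hΛ₂ f hk hf]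
  exact conjugate_comp_eq_comp_of_adelicCongr₂ σ.toRingEquiv m₁ m₂ _ _ f hf ℓ ℓ' hℓ y hy y' hy'

end SiegelAdelicMarking

end Literature.AlgebraicGeometry.ModuliOfAbelianVarieties

end
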